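import Summits.QuantumFields.GaugeBoot.PlaquetteStringSum
import Summits.QuantumFields.GaugeBoot.MoveLocality
import HarnessLib

/-!
# Plaquettes of a cube: counting, interior plaquettes and their depth (gauge-boot, ADDENDUM 28 part Z4)

HONEST FRAMING (cell `pub-gaugeboot`, page 1 of every file): the venture produces certified bounds
on lattice expectations at stated coupling, gauge group, dimension and torus size; NOT a mass gap,
NOT a continuum limit, NOT a string tension; NOT Yang–Mills-summit-bearing (barriers
`FixedCouplingUltralocality`, `PerturbativeInvisibility`).  Elementary lattice geometry for the proof of S. Chatterjee's
Corollary 3.4 (Comm. Math. Phys. **366** (2019), §15); nothing about four-dimensional continuum Yang–Mills or a mass gap.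

## Content

* `card_box` — `|[−n, n]^d| = (2n+1)^d`; `two_mul_card_pairsLT`, `card_pairsLT_real` — the number of coordinate planes
  `i < j` is `d(d−1)/2`;
* `plaquettesIn_subset_product` — the plaquettes of `Λ` inject into `Λ × {i < j}`; `box_product_subset_plaquettesIn` — the
  plaquettes based in the shrunken cube `[−(M−R−1), M−R−1]^d` lie in `[−M, M]^d`;
* `ball_plaquetteWord_box` — such a plaquette sits at depth `R` inside the cube (the Euclidean `R`-neighbourhood of its
  corners lies in `[−M, M]^d`), the hypothesis of the lane's quantitative duality `abs_phi_sub_trajectorySum_le_of_ball`;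
* `tendsto_card_box_ratio` — `|[−(M_N−R−1), M_N−R−1]^d| / |[−M_N, M_N]^d| → 1` when `M_N → ∞` (the source's «the proof is
  now completed by observing that `|𝒫_N'|/|Λ_N| → d(d−1)/2`»).

Everything is `[folklore]`.
-/

noncomputable section

open Filter Topology
open Literature.Probability.LatticeModels (Site box)
open Literature.MathematicalPhysics.QuantumLattice (ZdEdge ZdPlaquette)
open Literature.MathematicalPhysics.QuantumFieldTheory (latticeNorm plaquettesIn)
open Literature.MathematicalPhysics.QuantumFieldTheory.Chatterjee2019LargeN

namespace Summit.QuantumFields.GaugeBoot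

namespace StringDuality

variable {d : ℕ}

/-! ## Counting -/

/-- `|[−n, n]^d| = (2n + 1)^d`. [folklore] -/
theorem card_box (n : ℕ) : (box d n).card = (2 * n + 1) ^ d := by
  unfold box
  rw [Fintype.card_piFinset, Finset.prod_const, Finset.card_univ, Fintype.card_fin, Int.card_Icc]
  congr 1
  omega

/-- `|[−n, n]^d| > 0`. [folklore] -/
theorem card_box_pos (n : ℕ) : 0 < (box d n).card := by
  rw [card_box]; positivity

/-- Twice the number of coordinate planes `i < j` is `d² − d`. [folklore] -/
theorem two_mul_card_pairsLT :
    2 * (Finset.univ.filter fun q : Fin d × Fin d => q.1 < q.2).card = d * d - d := by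
  set A := Finset.univ.filter fun q : Fin d × Fin d => q.1 < q.2 with hA
  set B := Finset.univ.filter fun q : Fin d × Fin d => q.2 < q.1 with hB
  have hAB : A.card = B.card := by
    refine Finset.card_bij (fun q _ => q.swap) (fun q hq => ?_) (fun q₁ _ q₂ _ h => ?_) (fun q hq => ?_)
    · rw [hA, Finset.mem_filter] at hq; rw [hB, Finset.mem_filter]; exact ⟨Finset.mem_univ _, hq.2⟩
    · exact Prod.swap_injective h
    · rw [hB, Finset.mem_filter] at hq
      exact ⟨q.swap, by rw [hA, Finset.mem_filter]; exact ⟨Finset.mem_univ _, hq.2⟩, Prod.swap_swap q⟩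
  have hdisj : Disjoint A B := by
    rw [hA, hB, Finset.disjoint_filter]
    intro q _ h1 h2
    exact lt_asymm h1 h2
  have hunion : A ∪ B = (Finset.univ : Finset (Fin d)).offDiag := by
    ext q
    rw [Finset.mem_union, hA, hB, Finset.mem_filter, Finset.mem_filter, Finset.mem_offDiag]
    simp only [Finset.mem_univ, true_and]
    exact ⟨fun h => h.elim ne_of_lt (fun h' => (ne_of_lt h').symm), fun h => lt_or_gt_of_ne h⟩
  have hcard := Finset.card_union_of_disjoint hdisj
  rw [hunion, Finset.offDiag_card, Finset.card_univ, Fintype.card_fin, ← hAB] at hcard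
  omega

/-- The number of coordinate planes as a real number: `d(d−1)/2`. [folklore] -/
theorem card_pairsLT_real :
    ((Finset.univ.filter fun q : Fin d × Fin d => q.1 < q.2).card : ℝ) = (d : ℝ) * ((d : ℝ) - 1) / 2 := by
  have h := two_mul_card_pairsLT (d := d)
  have hd : d ≤ d * d := Nat.le_mul_self d
  have h' : (2 : ℝ) * (Finset.univ.filter fun q : Fin d × Fin d => q.1 < q.2).card = (d : ℝ) * d - d := by
    have := congrArg (fun n : ℕ => (n : ℝ)) h
    push_cast [Nat.cast_sub hd] at this
    exact this
  linarith

/-- The plaquettes of `Λ` inject into `Λ × {i < j}` (base point and plane). [folklore] -/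
theorem plaquettesIn_subset_product (Λ : Finset (Site d)) :
    plaquettesIn Λ ⊆ Λ ×ˢ (Finset.univ.filter fun q : Fin d × Fin d => q.1 < q.2) := by
  rintro ⟨x, i, j⟩ hq
  obtain ⟨hij, hx, -⟩ := SOMasterLoop.mem_plaquettesIn_iff.mp hq
  rw [Finset.mem_product, Finset.mem_filter]
  exact ⟨hx, Finset.mem_univ _, hij⟩

/-- `|𝒫_Λ| ≤ |Λ| · d(d−1)/2`. [folklore] -/
theorem card_plaquettesIn_le (Λ : Finset (Site d)) :
    ((plaquettesIn Λ).card : ℝ) ≤ Λ.card * ((d : ℝ) * ((d : ℝ) - 1) / 2) := by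
  have h := Finset.card_le_card (plaquettesIn_subset_product Λ)
  rw [Finset.card_product] at h
  rw [← card_pairsLT_real]
  exact_mod_cast h

/-- Points of the shrunken cube shifted by `0` or `1` in each coordinate stay in the cube. [folklore] -/
theorem mem_box_of_mem_box_sub {M R : ℕ} (hM : R + 1 ≤ M) {x u : Site d} (hx : x ∈ box d (M - (R + 1)))
    (hu : ∀ k, x k ≤ u k ∧ u k ≤ x k + 1) : u ∈ box d (M - R) := by
  rw [mem_box_iff] at hx ⊢
  intro k
  have h1 := hx k
  have h2 := hu k
  have hMR : ((M - (R + 1) : ℕ) : ℤ) = (M : ℤ) - R - 1 := by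
    rw [Nat.cast_sub hM]; push_cast; ring
  have hMR' : ((M - R : ℕ) : ℤ) = (M : ℤ) - R := by
    rw [Nat.cast_sub (by omega)]
  rw [hMR] at h1
  rw [hMR']
  constructor <;> linarith [h1.1, h1.2, h2.1, h2.2]

/-- The endpoints of the letters of a plaquette word are corners: coordinates between `x_k` and `x_k + 1`.
[cite: Chatterjee2019LargeN, §2.1 (the plaquette word)] -/
theorem corner_bounds {x : Site d} {ij : {q : Fin d × Fin d // q.1 < q.2}} {a : DEdge d}
    (ha : a ∈ plaquetteWord ⟨x, ij⟩) {u : Site d} (hu : u = DEdge.src a ∨ u = DEdge.tgt a) :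
    ∀ k, x k ≤ u k ∧ u k ≤ x k + 1 := by
  intro k
  have hs : ∀ m : Fin d, (0 : ℤ) ≤ (Pi.single m (1 : ℤ) : Site d) k ∧ (Pi.single m (1 : ℤ) : Site d) k ≤ 1 := by
    intro m
    by_cases h : k = m
    · subst h; simp
    · simp [h]
  have hsum : (Pi.single ij.1.1 (1 : ℤ) : Site d) k + (Pi.single ij.1.2 (1 : ℤ) : Site d) k ≤ 1 := by
    by_cases h1 : k = ij.1.1
    · subst h1
      have : (Pi.single ij.1.2 (1 : ℤ) : Site d) ij.1.1 = 0 := by simp [ne_of_lt ij.2]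
      rw [this]; simp
    · have : (Pi.single ij.1.1 (1 : ℤ) : Site d) k = 0 := by simp [h1]
      rw [this, zero_add]; exact (hs _).2
  simp only [plaquetteWord, List.mem_cons, List.not_mem_nil, or_false] at ha
  rcases ha with rfl | rfl | rfl | rfl <;>
    simp only [DEdge.src, DEdge.tgt, if_true, Bool.false_eq_true, if_false] at hu <;>
    rcases hu with rfl | rfl <;>
    (try simp only [Pi.add_apply]) <;>
    constructor <;>
    linarith [hs ij.1.1, hs ij.1.2, hsum]

/-- The plaquettes based in the shrunken cube `[−(M−R−1), M−R−1]^d` are plaquettes of `[−M, M]^d`. [folklore] -/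
theorem box_product_subset_plaquettesIn {M R : ℕ} (hM : R + 1 ≤ M) :
    box d (M - (R + 1)) ×ˢ (Finset.univ.filter fun q : Fin d × Fin d => q.1 < q.2) ⊆ plaquettesIn (box d M) := by
  rintro ⟨x, i, j⟩ hq
  rw [Finset.mem_product, Finset.mem_filter] at hq
  obtain ⟨hx, -, hij⟩ := hq
  have hsub : box d (M - R) ⊆ box d M := by
    intro y hy
    rw [mem_box_iff] at hy ⊢
    intro k
    have := hy k
    have hc : ((M - R : ℕ) : ℤ) ≤ M := by exact_mod_cast Nat.sub_le M R
    constructor <;> linarith [this.1, this.2]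
  have hs : ∀ (m : Fin d) (k : Fin d), (0 : ℤ) ≤ (Pi.single m (1 : ℤ) : Site d) k ∧ (Pi.single m (1 : ℤ) : Site d) k ≤ 1 := by
    intro m k
    by_cases h : k = m
    · subst h; simp
    · simp [h]
  have hc : ∀ u : Site d, (∀ k, x k ≤ u k ∧ u k ≤ x k + 1) → u ∈ box d M := fun u hu =>
    hsub (mem_box_of_mem_box_sub hM hx hu)
  rw [SOMasterLoop.mem_plaquettesIn_iff]
  refine ⟨hij, hc x fun k => ⟨le_rfl, by linarith⟩, hc _ fun k => ?_, hc _ fun k => ?_, hc _ fun k => ?_⟩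
  · simp only [Pi.add_apply]; constructor <;> linarith [hs i k]
  · simp only [Pi.add_apply]; constructor <;> linarith [hs j k]
  · simp only [Pi.add_apply]
    have hik := hs i k; have hjk := hs j k
    have : (Pi.single i (1 : ℤ) : Site d) k + (Pi.single j (1 : ℤ) : Site d) k ≤ 1 := by
      by_cases h1 : k = i
      · subst h1
        have : (Pi.single j (1 : ℤ) : Site d) k = 0 := by simp [ne_of_lt hij]
        rw [this]; simp
      · have : (Pi.single i (1 : ℤ) : Site d) k = 0 := by simp [h1]
        rw [this]; linarith
    constructor <;> linarith

/-! ## Depth of the interior plaquettes -/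

/-- A coordinate is bounded by the Euclidean length. [folklore] -/
theorem abs_apply_le_latticeNorm (w : Site d) (k : Fin d) : |((w k : ℤ) : ℝ)| ≤ latticeNorm w := by
  unfold latticeNorm
  have h := PiLp.norm_apply_le (WithLp.toLp 2 fun i => ((w i : ℤ) : ℝ) : EuclideanSpace ℝ (Fin d)) k
  simpa using h

/-- **The plaquettes based in `[−(M−R−1), M−R−1]^d` sit at depth `R` inside `[−M, M]^d`**: every lattice point within
Euclidean distance `R` of a corner lies in the cube. [folklore] -/
theorem ball_plaquetteWord_box {M R : ℕ} (hM : R + 1 ≤ M) {x : Site d} (hx : x ∈ box d (M - (R + 1)))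
    (ij : {q : Fin d × Fin d // q.1 < q.2}) :
    ∀ l ∈ ([plaquetteWord ⟨x, ij⟩] : LoopSeq d), ∀ a ∈ l, ∀ v : Site d,
      latticeNorm (v - DEdge.src a) ≤ (R : ℕ) ∨ latticeNorm (v - DEdge.tgt a) ≤ (R : ℕ) → v ∈ box d M := by
  intro l hl a ha v hv
  rw [List.mem_singleton] at hl
  subst hl
  obtain ⟨u, hu, hvu⟩ : ∃ u : Site d, (u = DEdge.src a ∨ u = DEdge.tgt a) ∧ latticeNorm (v - u) ≤ R := by
    rcases hv with hv | hv
    · exact ⟨_, Or.inl rfl, hv⟩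
    · exact ⟨_, Or.inr rfl, hv⟩
  have hcorner := mem_box_of_mem_box_sub hM hx (corner_bounds ha hu)
  rw [mem_box_iff] at hcorner ⊢
  intro k
  have h1 : |(((v - u) k : ℤ) : ℝ)| ≤ R := (abs_apply_le_latticeNorm (v - u) k).trans hvu
  have h2 : |(v k : ℤ) - u k| ≤ R := by
    rw [Pi.sub_apply] at h1
    exact_mod_cast h1
  have h3 := hcorner k
  have hMR : ((M - R : ℕ) : ℤ) = (M : ℤ) - R := by rw [Nat.cast_sub (by omega)]
  rw [hMR] at h3
  rw [abs_le] at h2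
  constructor <;> linarith [h2.1, h2.2, h3.1, h3.2]

/-! ## The volume ratio of the shrunken cube -/

/-- `|[−(M_N−R−1), M_N−R−1]^d| / |[−M_N, M_N]^d| → 1` as `M_N → ∞`.
[cite: Chatterjee2019LargeN, §15 («|𝒫_N'|/|Λ_N| → d(d−1)/2»)] -/
theorem tendsto_card_box_ratio (R : ℕ) {M : ℕ → ℕ} (hM : Tendsto M atTop atTop) :
    Tendsto (fun N : ℕ => ((box d (M N - (R + 1))).card : ℝ) / (box d (M N)).card) atTop (𝓝 1) := by
  -- the ratio is `((2M−2R−1)/(2M+1))^d = (1 − (2R+2)/(2M+1))^d` once `M ≥ R + 1`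
  have hden : Tendsto (fun N : ℕ => (2 * (M N : ℝ) + 1)) atTop atTop := by
    have h1 : Tendsto (fun N : ℕ => (M N : ℝ)) atTop atTop := tendsto_natCast_atTop_atTop.comp hM
    refine tendsto_atTop_add_const_right _ _ (Tendsto.const_mul_atTop (by norm_num) h1)
  have hfrac : Tendsto (fun N : ℕ => 1 - (2 * (R : ℝ) + 2) / (2 * (M N : ℝ) + 1)) atTop (𝓝 1) := by
    have h := (tendsto_const_nhds (x := (2 * (R : ℝ) + 2))).div_atTop hden
    simpa using (tendsto_const_nhds (x := (1 : ℝ))).sub h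
  have hpow := hfrac.pow d
  rw [one_pow] at hpow
  refine hpow.congr' ?_
  have hev : ∀ᶠ N : ℕ in atTop, R + 1 ≤ M N := (tendsto_atTop.mp hM) (R + 1)
  filter_upwards [hev] with N hN
  rw [card_box, card_box]
  have hpos : (0 : ℝ) < 2 * (M N : ℝ) + 1 := by positivity
  push_cast [Nat.cast_sub hN]
  rw [← div_pow]
  congr 1
  field_simp
  ring

end StringDuality

end Summit.QuantumFields.GaugeBoot

end
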